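import Mathlib.LinearAlgebra.Matrix.PosDef
import Mathlib.LinearAlgebra.Matrix.Hermitian
import HarnessLib

/-!
# `λ_max` of the dual slack over a box: the Perron–Frobenius / norm recipe for `ϱ_j` in Jansson's upper bound (Jansson 2006, §3)

Topic `Literature/Computation/Certificates`; companion of `SemidefiniteRigorousBoundsIndefinitePrimal.lean`
(Jansson 2006 Theorems 2 and 3).  Theorem 2 there (the rigorous UPPER bound of the dual optimal value of a block
SDP from an indefinite approximate primal `X̃`) has the hypothesis (7)

> `ϱ_j ≥ sup { λ_max(C_j − Σ_{i=1}^m y_i A_ij) : −ȳ ≤ y ≤ ȳ, C_j − Σ_{i=1}^m y_i A_ij ⪰ 0 }`,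

and the source says how a verifier obtains such a `ϱ_j` (p. 7, verbatim):

> Perron-Frobenius theory can be used for computing an upper bound of `ϱ_j`. It follows that an appropriate
> upper bound is `ϱ_j = ϱ(|C_j| + Σ_{i=1}^m ȳ_i |A_ij|)`, where `ϱ` denotes the spectral radius, which can be
> rigorously estimated by some norm.

* C. Jansson, *Rigorous Results in Combinatorial Optimization*, Dagstuhl Seminar Proceedings 05391 (IBFI Schloss
  Dagstuhl, 2006), paper 446 [Jansson2006Dagstuhl] — held text `paper:url-9569c35f2742`, p. 7, read on the page
  2026-08-26.

## What is proved (everything; no definitions, no named facts, no instances)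

Namespace `Literature.Computation.Certificates.Jansson2006`; "`λ_max(M) ≤ ϱ`" is written `ϱ·1 − M ⪰ 0`
(Loewner order, as in all companion files), `−ȳ ≤ y ≤ ȳ` is `∀ i, |y i| ≤ ybar i`.

* `posSemidef_smul_one_sub_of_abs_rowSum_le` — `λ_max(M) ≤ ‖M‖_∞`: for real symmetric `M` with absolute row
  sums `≤ ϱ`, `ϱ·1 − M ⪰ 0`;
* `posSemidef_smul_one_sub_of_abs_le_majorant` — the Perron–Frobenius comparison in Loewner form: `|M| ≤ N`
  entrywise and `ϱ·1 − N ⪰ 0` give `ϱ·1 − M ⪰ 0` (with `ϱ = λ_max(N) = ϱ(N)` this is `λ_max(M) ≤ ϱ(|M|) ≤ ϱ(N)`);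
* `abs_slack_apply_le` — `|(C − Σ_i y_i A_i)_ac| ≤ |C_ac| + Σ_i ȳ_i |(A_i)_ac|` on the box;
* `rho_of_majorant` — `N ≥ |C| + Σ_i ȳ_i |A_i|` entrywise and `ϱ·1 − N ⪰ 0` ⇒ `λ_max(C − Σ_i y_i A_i) ≤ ϱ` for
  every `y` in the box with symmetric (in particular PSD) slack — the printed `ϱ_j`;
* `rho_of_abs_rowSum_le` — the same from `‖ |C| + Σ_i ȳ_i |A_i| ‖_∞ ≤ ϱ` ("estimated by some norm").

The last two have exactly the shape of the hypothesis `hrho` of `Jansson2006.theorem_2` (apply per block `j`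
with `C := C_j`, `A := (A_ij)_i`).  Deliberately NOT here: the spectral radius itself (no `ϱ(N)` is defined — a
reader certifies `ϱ·1 − N ⪰ 0` for its own `ϱ` by exact `LDLᵀ` or by row sums); directed rounding.

## References

* [Jansson2006Dagstuhl] C. Jansson, Dagstuhl Seminar Proceedings 05391, paper 446 (2006), §3, remark after
  Theorem 3, p. 7.
* [HornJohnson2013] R. A. Horn, C. R. Johnson, *Matrix Analysis*, 2nd ed., Thm 8.1.18 (`ϱ(M) ≤ ϱ(|M|) ≤ ϱ(N)`
  for `|M| ≤ N`) and §5.6 (`ϱ(M) ≤ ‖M‖_∞`) — the classical facts behind the remark; proved here directly for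
  symmetric matrices in the Loewner-order form a reader checks.
-/

namespace Literature.Computation.Certificates.Jansson2006

open Matrix Finset
open scoped BigOperators

/-! ### `λ_max` bounds a certificate reader can check: `ϱ·1 − M ⪰ 0` from row sums or from a majorant -/

section LambdaMax

variable {n : Type*} [Fintype n] [DecidableEq n]

omit [DecidableEq n] in
/-- `xᵀMx ≤ Σ_a Σ_c |M_ac| |x_a| |x_c|` (plumbing). [folklore] -/
private theorem form_le_abs_form (M : Matrix n n ℝ) (x : n → ℝ) :
    x ⬝ᵥ (M *ᵥ x) ≤ ∑ a, ∑ c, |M a c| * (|x a| * |x c|) := by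
  have h : x ⬝ᵥ (M *ᵥ x) = ∑ a, ∑ c, M a c * (x a * x c) := by
    simp only [dotProduct, mulVec, Finset.mul_sum]
    exact Finset.sum_congr rfl fun a _ => Finset.sum_congr rfl fun c _ => by ring
  rw [h]
  refine Finset.sum_le_sum fun a _ => Finset.sum_le_sum fun c _ => ?_
  rw [← abs_mul, ← abs_mul]
  exact le_abs_self _

/-- theorem (**`λ_max(M) ≤ ‖M‖_∞`** in Loewner form). If `M` is real symmetric and every absolute row sum
satisfies `Σ_c |M_ac| ≤ ϱ`, then `ϱ·1 − M ⪰ 0` (i.e. `λ_max(M) ≤ ϱ`).  (`xᵀMx ≤ Σ |M_ac||x_a||x_c| ≤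
Σ |M_ac|(x_a² + x_c²)/2 ≤ ϱ‖x‖²`, using the column sums `=` row sums by symmetry.)  This is the "rigorously
estimated by some norm" clause of the source's remark on `ϱ_j`.
SOURCE: [cite: Jansson2006Dagstuhl, §3, remark after Thm 3 (p. 7, "which can be rigorously estimated by some
norm")] — read on the page 2026-08-26; the inequality itself is classical ([HornJohnson2013] §5.6,
`ϱ(M) ≤ ‖M‖_∞`); DEVIATIONS from print: stated for the `∞`-norm and in the Loewner-order form a reader checks.
CERTIFICATE KIND: λ_max bound by absolute row sums; FIELDS: `M ↦` the symmetric matrix, `rho ↦ ϱ`.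
NOT COVERED: the directed-rounding evaluation of the row sums. -/
theorem posSemidef_smul_one_sub_of_abs_rowSum_le {M : Matrix n n ℝ} (hM : M.IsHermitian) {rho : ℝ}
    (hrow : ∀ a, ∑ c, |M a c| ≤ rho) : (rho • (1 : Matrix n n ℝ) - M).PosSemidef := by
  have hsymm : ∀ a c, M c a = M a c := fun a c => by simpa using hM.apply a c
  have hcol : ∀ c, ∑ a, |M a c| ≤ rho := fun c =>
    (Finset.sum_congr rfl fun a _ => by rw [hsymm c a]).trans_le (hrow c)
  refine PosSemidef.of_dotProduct_mulVec_nonneg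
    ((isHermitian_one.smul (IsSelfAdjoint.all rho)).sub hM) fun x => ?_
  have hxx : x ⬝ᵥ x = ∑ a, x a ^ 2 := by simp only [dotProduct, sq]
  have hbound : ∑ a, ∑ c, |M a c| * (|x a| * |x c|) ≤ rho * ∑ a, x a ^ 2 :=
    calc ∑ a, ∑ c, |M a c| * (|x a| * |x c|)
        ≤ ∑ a, ∑ c, (|M a c| * (x a ^ 2 / 2) + |M a c| * (x c ^ 2 / 2)) := by
          refine Finset.sum_le_sum fun a _ => Finset.sum_le_sum fun c _ => ?_
          rw [← mul_add]
          refine mul_le_mul_of_nonneg_left ?_ (abs_nonneg _)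
          nlinarith [sq_nonneg (|x a| - |x c|), sq_abs (x a), sq_abs (x c)]
      _ = ∑ a, ∑ c, |M a c| * (x a ^ 2 / 2) + ∑ a, ∑ c, |M a c| * (x c ^ 2 / 2) := by
          rw [← Finset.sum_add_distrib]
          exact Finset.sum_congr rfl fun a _ => Finset.sum_add_distrib
      _ ≤ ∑ a, rho * (x a ^ 2 / 2) + ∑ c, rho * (x c ^ 2 / 2) := by
          refine add_le_add (Finset.sum_le_sum fun a _ => ?_) ?_
          · rw [← Finset.sum_mul]
            exact mul_le_mul_of_nonneg_right (hrow a) (by positivity)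
          · rw [Finset.sum_comm]
            refine Finset.sum_le_sum fun c _ => ?_
            rw [← Finset.sum_mul]
            exact mul_le_mul_of_nonneg_right (hcol c) (by positivity)
      _ = rho * ∑ a, x a ^ 2 := by
          rw [← two_mul, Finset.mul_sum, Finset.mul_sum]
          exact Finset.sum_congr rfl fun a _ => by ring
  rw [star_trivial, Matrix.sub_mulVec, dotProduct_sub, Matrix.smul_mulVec, Matrix.one_mulVec,
    dotProduct_smul, smul_eq_mul, hxx]
  have h1 := form_le_abs_form M x
  linarith

/-- theorem (**Perron–Frobenius comparison** in Loewner form). If `M` is real symmetric, `|M_ac| ≤ N_ac` for all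
entries, and `ϱ·1 − N ⪰ 0`, then `ϱ·1 − M ⪰ 0`.  (`xᵀMx ≤ |x|ᵀN|x| ≤ ϱ |x|ᵀ|x| = ϱ xᵀx`.)  With
`ϱ = λ_max(N)` (`= ϱ(N)` for the symmetric nonnegative `N`) this is `λ_max(M) ≤ ϱ(|M|) ≤ ϱ(N)`, the
"Perron-Frobenius theory" step of the source's remark on `ϱ_j`; a reader may instead certify `ϱ·1 − N ⪰ 0`
for any convenient `ϱ` (exact `LDLᵀ`, or row sums via `posSemidef_smul_one_sub_of_abs_rowSum_le`).
SOURCE: [cite: Jansson2006Dagstuhl, §3, remark after Thm 3 (p. 7, "Perron-Frobenius theory can be used for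
computing an upper bound of `ϱ_j`")] — read on the page 2026-08-26; classical fact [HornJohnson2013] Thm
8.1.18; DEVIATIONS from print: Loewner-order form with an arbitrary certified `ϱ` in place of the spectral
radius of `N`.  CERTIFICATE KIND: λ_max bound by an entrywise majorant; FIELDS: `M`, `N ↦` majorant, `rho ↦ ϱ`.
NOT COVERED: how `ϱ·1 − N ⪰ 0` is certified. -/
theorem posSemidef_smul_one_sub_of_abs_le_majorant {M N : Matrix n n ℝ} (hM : M.IsHermitian)
    (hMN : ∀ a c, |M a c| ≤ N a c) {rho : ℝ} (hN : (rho • (1 : Matrix n n ℝ) - N).PosSemidef) :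
    (rho • (1 : Matrix n n ℝ) - M).PosSemidef := by
  refine PosSemidef.of_dotProduct_mulVec_nonneg
    ((isHermitian_one.smul (IsSelfAdjoint.all rho)).sub hM) fun x => ?_
  set ax : n → ℝ := fun a => |x a| with hax
  have h0 := hN.dotProduct_mulVec_nonneg ax
  have hxx : x ⬝ᵥ x = ax ⬝ᵥ ax := by
    simp only [dotProduct, hax]
    exact Finset.sum_congr rfl fun a _ => (abs_mul_abs_self (x a)).symm
  have hform : ax ⬝ᵥ (N *ᵥ ax) = ∑ a, ∑ c, N a c * (|x a| * |x c|) := by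
    simp only [dotProduct, mulVec, hax, Finset.mul_sum]
    exact Finset.sum_congr rfl fun a _ => Finset.sum_congr rfl fun c _ => by ring
  have h1 : x ⬝ᵥ (M *ᵥ x) ≤ ax ⬝ᵥ (N *ᵥ ax) := by
    rw [hform]
    refine (form_le_abs_form M x).trans (Finset.sum_le_sum fun a _ => Finset.sum_le_sum fun c _ => ?_)
    exact mul_le_mul_of_nonneg_right (hMN a c) (mul_nonneg (abs_nonneg _) (abs_nonneg _))
  rw [star_trivial, Matrix.sub_mulVec, dotProduct_sub, Matrix.smul_mulVec, Matrix.one_mulVec,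
    dotProduct_smul, smul_eq_mul] at h0 ⊢
  rw [hxx]
  linarith

variable {μ : Type*} [Fintype μ]

omit [Fintype n] [DecidableEq n] in
/-- `|(C − Σ_i y_i A_i)_ac| ≤ |C_ac| + Σ_i ȳ_i |(A_i)_ac|` for `|y| ≤ ȳ` (plumbing: the entrywise majorant of every
slack matrix over the box). [cite: Jansson2006Dagstuhl, §3, remark after Thm 3 (p. 7, `|C_j| + Σ ȳ_i |A_ij|`)] -/
theorem abs_slack_apply_le (C : Matrix n n ℝ) (A : μ → Matrix n n ℝ) (ybar : μ → ℝ) {y : μ → ℝ}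
    (hyb : ∀ i, |y i| ≤ ybar i) (a c : n) :
    |(C - ∑ i, y i • A i) a c| ≤ |C a c| + ∑ i, ybar i * |A i a c| := by
  rw [Matrix.sub_apply, Matrix.sum_apply]
  simp only [Matrix.smul_apply, smul_eq_mul]
  refine (abs_sub _ _).trans (add_le_add le_rfl ?_)
  refine (Finset.abs_sum_le_sum_abs _ _).trans (Finset.sum_le_sum fun i _ => ?_)
  rw [abs_mul]
  exact mul_le_mul_of_nonneg_right (hyb i) (abs_nonneg _)

/-- theorem (the source's recipe for `ϱ_j`, majorant form). If `N ≥ |C| + Σ_i ȳ_i |A_i|` entrywise and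
`ϱ·1 − N ⪰ 0`, then EVERY `y` with `|y| ≤ ȳ` whose slack `C − Σ_i y_i A_i` is positive semidefinite (indeed:
symmetric) has `λ_max(C − Σ_i y_i A_i) ≤ ϱ`, i.e. `ϱ` satisfies hypothesis (7) of Theorem 2 for this block.
Shape: exactly the `hrho` hypothesis of `theorem_2` (apply per block `j` with `C := C_j`, `A := (A_ij)_i`).
SOURCE: [cite: Jansson2006Dagstuhl, §3, remark after Thm 3 (p. 7): "an appropriate upper bound is
`ϱ_j = ϱ(|C_j| + Σ_{i=1}^m ȳ_i |A_ij|)`"] — read on the page 2026-08-26; DEVIATIONS from print: the spectral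
radius `ϱ(N)` is replaced by any `ϱ` with a certified `ϱ·1 − N ⪰ 0` (for `ϱ = ϱ(N) = λ_max(N)` this is the
printed value), and the PSD side condition of (7) is used only through symmetry of the slack.
CERTIFICATE KIND: λ_max bound over a box (field `ϱ_j` of a primal-residual upper certificate);
FIELDS: `C ↦ C_j`, `A ↦ (A_ij)_i`, `ybar ↦ ȳ`, `N ↦` majorant, `rho ↦ ϱ_j`.
NOT COVERED: how `ϱ·1 − N ⪰ 0` and the entrywise majorant are certified in machine arithmetic. -/
theorem rho_of_majorant (C : Matrix n n ℝ) (A : μ → Matrix n n ℝ) (ybar : μ → ℝ) (N : Matrix n n ℝ)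
    (hN : ∀ a c, |C a c| + ∑ i, ybar i * |A i a c| ≤ N a c) {rho : ℝ}
    (hrhoN : (rho • (1 : Matrix n n ℝ) - N).PosSemidef) (y : μ → ℝ) (hyb : ∀ i, |y i| ≤ ybar i)
    (hD : (C - ∑ i, y i • A i).PosSemidef) :
    (rho • (1 : Matrix n n ℝ) - (C - ∑ i, y i • A i)).PosSemidef :=
  posSemidef_smul_one_sub_of_abs_le_majorant hD.1
    (fun a c => (abs_slack_apply_le C A ybar hyb a c).trans (hN a c)) hrhoN

/-- theorem (the source's recipe for `ϱ_j`, norm form). If every absolute row sum of `|C| + Σ_i ȳ_i |A_i|` is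
`≤ ϱ` (`‖ |C| + Σ ȳ_i|A_i| ‖_∞ ≤ ϱ`), then every `y` with `|y| ≤ ȳ` whose slack is positive semidefinite
(indeed: symmetric) has `λ_max(C − Σ_i y_i A_i) ≤ ϱ` — hypothesis (7) of Theorem 2 for this block, in the
shape `theorem_2` consumes.
SOURCE: [cite: Jansson2006Dagstuhl, §3, remark after Thm 3 (p. 7): `ϱ(|C_j| + Σ ȳ_i|A_ij|)` "can be
rigorously estimated by some norm"] — read on the page 2026-08-26; DEVIATIONS from print: the norm is fixed to
the `∞`-norm (maximal absolute row sum).  CERTIFICATE KIND: λ_max bound over a box by row sums;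
FIELDS: `C ↦ C_j`, `A ↦ (A_ij)_i`, `ybar ↦ ȳ`, `rho ↦ ϱ_j`.
NOT COVERED: the directed-rounding evaluation of the row sums. -/
theorem rho_of_abs_rowSum_le (C : Matrix n n ℝ) (A : μ → Matrix n n ℝ) (ybar : μ → ℝ) {rho : ℝ}
    (hrow : ∀ a, ∑ c, (|C a c| + ∑ i, ybar i * |A i a c|) ≤ rho) (y : μ → ℝ)
    (hyb : ∀ i, |y i| ≤ ybar i) (hD : (C - ∑ i, y i • A i).PosSemidef) :
    (rho • (1 : Matrix n n ℝ) - (C - ∑ i, y i • A i)).PosSemidef :=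
  posSemidef_smul_one_sub_of_abs_rowSum_le hD.1 fun a =>
    (Finset.sum_le_sum fun c _ => abs_slack_apply_le C A ybar hyb a c).trans (hrow a)

end LambdaMax

end Literature.Computation.Certificates.Jansson2006
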